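import Literature.AlgebraicGeometry.HodgeTheory.UnitaryTypeSlotsHodgeClasses
import Literature.AlgebraicGeometry.Motives.HodgeThetaSubalgebraUnitaryQuartic
import Literature.RepresentationTheory.ClassicalInvariants.MixedTensorLieInvariantsGLColoured
import HarnessLib

/-!
# Hodge classes on abelian varieties with slots over `A` are generated by divisor classes when `H¹(A)` carries a quartic CM structure of multiplicities `{(1,1), (2,0)}` — the Lie step `𝔲_E(V, ψ)_ℂ ≅ 𝔤𝔩(W_{μ₁}) × 𝔤𝔩(W_{μ₂})`, the coloured unipotent bridge and the tensor FFT for `GL × GL` (Moonen–Zarhin 1999 Thm. (0.2)(4), simple Type IV(2,1); Milne 1999 Prop. 3.6 (c))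

Family `hodge`, layer `Literature/AlgebraicGeometry/HodgeTheory`. Research context: cell `pub-hodge-ring2`
(HONEST FRAMING: research route conditional on HC_CM; not a corollary; Q11.4-sentence-2 already refuted in
dim ≥ 3), Literature lane, programme R10 «type IV(2,1) fourfolds», the abstract-data half of the geometric
step. UNCONDITIONAL; no definition, no named fact, no `sorry` (D-0026). It is the two-colour companion of the
tree's `HodgeTheory/UnitaryTypeSlotsHodgeClasses` (Ribet type `(m, 1)`, one colour), whose word-model
(`blockLiftGen`, `placeRefineGen`) and transport it reuses by name. The geometric discharge of the data from a
simple abelian fourfold `A` with `End⁰(A) = E` a quartic CM field acting with multiplicities `{(1,1),(2,0)}` is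
the sequel `HodgeTheory/QuarticCMTwoOnePowersHodgeClasses`.

THE PRINTED THEOREM (Moonen–Zarhin 1999, Thm. (0.2)(4) [corpus: arXiv:math/9901113 p. 1]: for `dim X = 4`
outside the cases (a)–(d), "`Hg(X) = Sp_D(V,φ)` and `B(Xⁿ) = D(Xⁿ)` for all `n`"; (2.4) p. 5: "in op. cit.
[MZ95] we already proved Theorem (0.2) for simple abelian fourfolds"). A simple fourfold with `End⁰ = E` a
quartic CM field is outside (a), (c), (d), and outside (b) exactly when no imaginary quadratic subfield acts with
multiplicities `(2,2)`, which for the `E`-signature `{(1,1),(2,0)}` is automatic.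

DATA (all on the `ℚ`-Hodge structure `H = H¹(A(ℂ); ℚ)` of the tree's Betti universe, `V = H¹(A(ℂ); ℚ)`):
a polarization `ψ`; `φ ∈ End_Hdg(V)` with `End_Hdg(V) = Σ_{k<4} ℚφ^k` a field (left inverses); `dim_ℚ V = 8`;
`μ : Fin 2 → ℂ` with `μ 0, conj μ 0, μ 1, conj μ 1` pairwise distinct; `W_c = ker(φ_ℂ - c)`,
`dim(W_{μ 0} ∩ V^{1,0}) = dim(W_{μ 0} ∩ V^{0,1}) = 1`, `dim(W_{μ 1} ∩ V^{1,0}) = 2`; and an abelian variety `B`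
with slots `g` over `A` (`AVSlots`, e.g. `B = A^{N+1}`).

MAIN RESULTS.
* §2 `HodgeStructure.QuarticTheta.pairing_bijective` (the graded pieces of `W_c` and `W_{conj c}` are in perfect
  `ψ_ℂ`-duality, any `c`) and `HodgeStructure.QuarticTheta.exists_adaptedDualBasis` — a basis
  `cb ((k,t),ℓ)` (`k` colour, `t` type, `ℓ ∈ Fin 2`) of `V_ℂ` with `cb((k,0),ℓ) ∈ W_{μ k}`,
  `cb((k,1),ℓ) ∈ W_{conj μ k}` of pure Hodge types (kinds `κ`), `ψ_ℂ(cb((k,0),i), cb((k',1),j)) = δ_{kk'}δ_{ij}`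
  and `ψ_ℂ = 0` on equal types.
* §3 `AVSlots.exists_quarticInvariant_coeff` — THE INVARIANCE THEOREM: every rational `(p,p)`-class on `B` is
  `∑_w a(w)·(g cb)_w` for a coefficient function `a` on words in the letters `((j, (k, t)), ℓ)` (slot, colour,
  type, index) whose slices along every slot-colour-type word `U` are killed, for each colour `k` and EVERY
  `X ∈ 𝔤𝔩_{n₀}(ℂ)`, by the typed differential of `X` placed at the positions of colour `k` (`X` at type `0`,
  `-Xᵀ` at type `1`, `0` at the other colour) — THEOREM L″ of `HodgeThetaSubalgebraUnitaryQuartic` transported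
  to the adapted letters.
* §4 `AVSlots.quarticHodgeClasses_divisorial`, `AVSlots.isDivisorGenerated_of_quarticData` — THE ASSEMBLY:
  coloured Lie invariance ⟹ invariance under `GL_{n₀} × GL_{n₀}`
  (`ClassicalInvariants.wordRepAt_mixedFamily_eq_self_of_forall_wordDerAt_mixedLieFamilyAt_eq_zero`) ⟹ each
  slice is a combination of COLOUR-PRESERVING complete contractions (coloured tensor FFT,
  `mem_span_contractionTensor_of_forall_wordDerAt_mixedLieFamilyAt_eq_zero`) ⟹ evaluates to `±` products of the
  crossed classes `∑_ℓ g_j^* cb((k,0),ℓ) ⌣ g_{j'}^* cb((k,1),ℓ)` of ONE colour each (Milne 1999 Prop. 3.6 (c),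
  Remark 3.7: `sum_contractionTensor_smul_eq`, `sum_cupPowOne_glPairWord_mem`), which are divisor classes by the
  hypothesis `hcross` (discharged in the sequel from the `ψ`-Casimir classes of `1, φ, φ²`).

## References

* [MoonenZarhin1999LowDim] B. Moonen, Yu. Zarhin, *Hodge classes on abelian varieties of low dimension*, Math.
  Ann. 315 (1999) = arXiv:math/9901113 (held `paper:arxiv-math_9901113`), Thm. (0.2)(4), §2 (2.4), §3 (3.1).
* [MoonenZarhin1995Duke] B. Moonen, Yu. Zarhin, Duke Math. J. 77 (1995) 553–581 (proof for simple fourfolds).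
* [Milne1999LefschetzClasses] J. S. Milne, *Lefschetz classes on abelian varieties*, Duke Math. J. 96 (1999),
  §2 p. 651, Prop. 3.6 (c), Remark 3.7, p. 656.
* [GoodmanWallachGTM255] R. Goodman, N. R. Wallach, GTM 255 (2009), Thm. 2.2.2, §4.1.1, Thm. 5.3.1.
* [Gordon1997] B. B. Gordon, *A survey of the Hodge conjecture for abelian varieties*, arXiv:alg-geom/9709030,
  §6 (proof of Thm. 6.3.3, pp. 18–19).
* [FultonYoungTableaux1997] W. Fulton, *Young Tableaux* (1997), §8.1.
* [VoisinHodgeI2002] C. Voisin, *Hodge Theory and Complex Algebraic Geometry I*, §7.1.2 Def. 7.7.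
* [Deligne1982HodgeCycles] P. Deligne, *Hodge cycles on abelian varieties*, LNM 900 (1982), §4 p. 30.
-/

noncomputable section

open scoped TensorProduct
open scoped Matrix
open CategoryTheory Module

namespace Literature.AlgebraicGeometry.Motives

namespace HodgeStructure

/-! ### §2 Adapted `ψ_ℂ`-dual bases of `V_ℂ = ⊕_c W_c` for a quartic CM structure of weight one -/

section QuarticDualBases

universe u

variable {V : Type u} [AddCommGroup V] [Module ℚ V] {n : ℤ}

/-- The two elements of `Fin 2`. [folklore] -/
private theorem QuarticTheta.fin2_cases (r : Fin 2) : r = 0 ∨ r = 1 := by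
  fin_cases r <;> simp

/-- **The graded pieces of `W_c` and `W_{conj c}` are in perfect `ψ_ℂ`-duality** (any eigenvalue `c` of a
real operator `φ_ℂ`): for `p + q = 1` the map `y' ↦ ψ_ℂ(·, y')`, `W_{conj c} ∩ V^{q,p} → (W_c ∩ V^{p,q})^*`, is
bijective — injective by the second Hodge–Riemann relation (`ψ_ℂ(conj y', y') ≠ 0`, `conj y' ∈ W_c ∩ V^{p,q}`),
and the dimensions agree (`W_{conj c} ∩ V^{q,p} = conj(W_c ∩ V^{p,q})`). (The tree's
`UnitaryTheta.pairing_bijective` is the case `conj c = -c`; Deligne §4: `ψ` pairs `H¹_σ` with `H¹_σ̄`.)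
[cite: Deligne1982HodgeCycles, §4 (p. 30)] [cite: VoisinHodgeI2002, §7.1.2 Def. 7.7]
[cite: Gordon1997, §6 (proof of Thm. 6.3.3, p. 19)] -/
theorem QuarticTheta.pairing_bijective [Module.Finite ℚ V] (H : HodgeStructure V n) (hn : n = 1)
    (ψ : H.Polarization) (φ : Module.End ℚ V) (c : ℂ) (p q : ℤ) (hpq : p + q = 1) :
    Function.Bijective
      (((ψ.form.baseChange ℂ).domRestrict₁₂ (Module.End.eigenspace (φ.baseChange ℂ) c ⊓ H.piece p q)
        (Module.End.eigenspace (φ.baseChange ℂ) (starRingEnd ℂ c) ⊓ H.piece q p)).flip :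
        ↥(Module.End.eigenspace (φ.baseChange ℂ) (starRingEnd ℂ c) ⊓ H.piece q p) →ₗ[ℂ]
          Module.Dual ℂ ↥(Module.End.eigenspace (φ.baseChange ℂ) c ⊓ H.piece p q)) := by
  subst hn
  set S := Module.End.eigenspace (φ.baseChange ℂ) c ⊓ H.piece p q with hSdef
  set S' := Module.End.eigenspace (φ.baseChange ℂ) (starRingEnd ℂ c) ⊓ H.piece q p with hS'def
  set Φ := ((ψ.form.baseChange ℂ).domRestrict₁₂ S S').flip with hΦdef
  have hΦ : ∀ (y' : S') (x : S), Φ y' x = ψ.form.baseChange ℂ x y' := fun y' x => by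
    rw [hΦdef, LinearMap.flip_apply, LinearMap.domRestrict₁₂_apply]
  have hSS' : S = complexConj S' := by
    rw [hS'def, hSdef, complexConj_inf, complexConj_piece, EndAction.complexConj_eigenspace_baseChange,
      starRingEnd_self_apply]
  have hconj : ∀ y' ∈ S', conj y' ∈ S := fun y' hy' => by
    rw [hSS', mem_complexConj, conj_conj]
    exact hy'
  have hinj : Function.Injective Φ := by
    rw [injective_iff_map_eq_zero]
    intro y' hy'
    have h : ψ.form.baseChange ℂ (conj (y' : ℂ ⊗[ℚ] V)) y' = 0 := by
      rw [← hΦ y' ⟨_, hconj _ y'.2⟩, hy', LinearMap.zero_apply]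
    have h0 : conj (y' : ℂ ⊗[ℚ] V) = 0 := by
      by_contra hne
      refine ψ.form_conj_ne_zero hpq (hconj _ y'.2).2 hne ?_
      rw [conj_conj]
      exact h
    exact Subtype.ext (by rw [← conj_conj (y' : ℂ ⊗[ℚ] V), h0, map_zero]; rfl)
  have hdim : Module.finrank ℂ S' = Module.finrank ℂ S := by
    rw [hSS', finrank_complexConj]
  exact ⟨hinj, (LinearMap.injective_iff_surjective_of_finrank_eq_finrank
    (hdim.trans (Subspace.dual_finrank_eq (K := ℂ) (V := ↥S)).symm)).1 hinj⟩

/-- **Adapted `ψ_ℂ`-dual bases of `V_ℂ = W_{μ₀} ⊕ W_{conj μ₀} ⊕ W_{μ₁} ⊕ W_{conj μ₁}`** for a quartic CM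
structure of multiplicities `{(1,1),(2,0)}` (setting of `QuarticTheta.mem_spanC_of_commute_of_skew`, with
`μ₁, μ₂` renamed `μ 0, μ 1`): a basis `cb ((k, t), ℓ)` of `V_ℂ` and kinds `κ (k, ℓ)` with `cb((k,0),ℓ) ∈ W_{μ k}`,
`cb((k,1),ℓ) ∈ W_{conj μ k}`, `cb((k,0),ℓ) ∈ V^{1,0}, cb((k,1),ℓ) ∈ V^{0,1}` for `κ = 0` and the opposite types
for `κ = 1`, `ψ_ℂ(cb((k,0),i), cb((k',1),j)) = δ_{kk'} δ_{ij}`, and `ψ_ℂ = 0` on two letters of the same type.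
Construction: colour `0` — generators `e₀, e₁` of the lines `W_{μ 0} ∩ V^{1,0}`, `W_{μ 0} ∩ V^{0,1}` and the dual
vectors `ψ_ℂ(e_i, conj e_i)⁻¹ conj e_i`; colour `1` — a basis of the plane `W_{μ 1} = W_{μ 1} ∩ V^{1,0}` and its
dual basis of `W_{conj μ 1} ⊆ V^{0,1}` (`pairing_bijective`); independence by the pairing table
(`QuarticTheta.form_eq_zero_of_ne`: `ψ_ℂ(W_a, W_b) = 0` unless `b = conj a`), spanning by
`QuarticTheta.eigenspace_facts`. In these letters every `Y ∈ 𝔲_E(V, ψ)_ℂ` has matrix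
`(X₀ ⊕ -X₀ᵀ) ⊕ (X₁ ⊕ -X₁ᵀ)` (Milne: "the standard representation and its contragredient", per place).
[cite: Deligne1982HodgeCycles, §4 (p. 30)] [cite: Milne1999LefschetzClasses, §2 p. 651]
[cite: VoisinHodgeI2002, §7.1.2 Def. 7.7] -/
theorem QuarticTheta.exists_adaptedDualBasis [Module.Finite ℚ V] [HodgeTensorFacts.{u, u}]
    (H : HodgeStructure V n) (hn : n = 1) (heff : H.IsEffective) (ψ : H.Polarization) {φ : Module.End ℚ V}
    (hφE : φ ∈ H.endAlg) (hE : ∀ a ∈ H.endAlg, ∃ q : Fin 4 → ℚ, a = ∑ k, q k • φ ^ (k : ℕ))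
    (μ : Fin 2 → ℂ) (h11 : starRingEnd ℂ (μ 0) ≠ μ 0) (h22 : starRingEnd ℂ (μ 1) ≠ μ 1) (h12 : μ 1 ≠ μ 0)
    (h12' : μ 1 ≠ starRingEnd ℂ (μ 0)) (hV : Module.finrank ℚ V = 8)
    (h1a : Module.finrank ℂ ↥(Module.End.eigenspace (φ.baseChange ℂ) (μ 0) ⊓ H.piece 1 0) = 1)
    (h1b : Module.finrank ℂ ↥(Module.End.eigenspace (φ.baseChange ℂ) (μ 0) ⊓ H.piece 0 1) = 1)
    (h2a : Module.finrank ℂ ↥(Module.End.eigenspace (φ.baseChange ℂ) (μ 1) ⊓ H.piece 1 0) = 2) :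
    ∃ (cb : Module.Basis ((Fin 2 × Fin 2) × Fin 2) ℂ (ℂ ⊗[ℚ] V)) (κ : Fin 2 × Fin 2 → Fin 2),
      (∀ k ℓ, cb ((k, 0), ℓ) ∈ Module.End.eigenspace (φ.baseChange ℂ) (μ k)) ∧
      (∀ k ℓ, cb ((k, 1), ℓ) ∈ Module.End.eigenspace (φ.baseChange ℂ) (starRingEnd ℂ (μ k))) ∧
      (∀ k ℓ, κ (k, ℓ) = 0 → cb ((k, 0), ℓ) ∈ H.piece 1 0 ∧ cb ((k, 1), ℓ) ∈ H.piece 0 1) ∧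
      (∀ k ℓ, κ (k, ℓ) = 1 → cb ((k, 0), ℓ) ∈ H.piece 0 1 ∧ cb ((k, 1), ℓ) ∈ H.piece 1 0) ∧
      (∀ k k' i j, ψ.form.baseChange ℂ (cb ((k, 0), i)) (cb ((k', 1), j)) =
        if k = k' ∧ i = j then 1 else 0) ∧
      (∀ k k' (t : Fin 2) i j, ψ.form.baseChange ℂ (cb ((k, t), i)) (cb ((k', t), j)) = 0) := by
  classical
  subst hn
  obtain ⟨Θ, hΘ⟩ := exists_hodgeTheta H
  obtain ⟨hP, hQ, hΘ10, hΘ01, -⟩ := UnitaryTheta.theta_facts H rfl heff hΘ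
  set F := φ.baseChange ℂ with hF
  set ψC := ψ.form.baseChange ℂ with hψC
  have hΘφ : Θ * F = F * Θ :=
    commute_baseChange_of_mem_hodgeLieC H (H.mem_hodgeLieC_of_forall_piece hΘ) ⟨φ, hφE⟩
  have hΘW : ∀ c, ∀ w ∈ Module.End.eigenspace F c, Θ w ∈ Module.End.eigenspace F c := fun c w hw =>
    UnitaryTheta.apply_mem_eigenspace_of_commute hΘφ hw
  obtain ⟨hW₂10, hf2, htop, -, -⟩ :=
    QuarticTheta.eigenspace_facts H rfl heff hΘ hΘφ h11 h22 h12 h12' hV h1a h1b h2a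
  have hswap : ∀ x y, ψC y x = -ψC x y := fun x y => by
    rw [hψC, ψ.form_baseChange_swap, show (1 : ℤ).negOnePow = -1 from Int.negOnePow_one]
    simp
  have h1100 : ∀ x ∈ H.piece 1 0, ∀ y ∈ H.piece 1 0, ψC x y = 0 := fun x hx y hy =>
    ψ.form_piece_piece (p := 1) (p' := 1) (by norm_num) (by simpa using hx) (by simpa using hy)
  have h0101 : ∀ x ∈ H.piece 0 1, ∀ y ∈ H.piece 0 1, ψC x y = 0 := fun x hx y hy =>
    ψ.form_piece_piece (p := 0) (p' := 0) (by norm_num) (by simpa using hx) (by simpa using hy)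
  have hcc : ∀ k, starRingEnd ℂ (starRingEnd ℂ (μ k)) = μ k := fun k => starRingEnd_self_apply _
  -- colour `0`: the lines `W(μ 0) ∩ V^{1,0} = ℂ e₀`, `W(μ 0) ∩ V^{0,1} = ℂ e₁` and the dual vectors
  haveI : Nontrivial ↥(Module.End.eigenspace F (μ 0) ⊓ H.piece 1 0) :=
    Module.nontrivial_of_finrank_pos (R := ℂ) (by rw [h1a]; exact one_pos)
  haveI : Nontrivial ↥(Module.End.eigenspace F (μ 0) ⊓ H.piece 0 1) :=
    Module.nontrivial_of_finrank_pos (R := ℂ) (by rw [h1b]; exact one_pos)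
  obtain ⟨⟨e₀, he₀⟩, he₀0'⟩ := exists_ne (0 : ↥(Module.End.eigenspace F (μ 0) ⊓ H.piece 1 0))
  obtain ⟨⟨e₁, he₁⟩, he₁0'⟩ := exists_ne (0 : ↥(Module.End.eigenspace F (μ 0) ⊓ H.piece 0 1))
  have he₀0 : e₀ ≠ 0 := fun h => he₀0' (Subtype.ext h)
  have he₁0 : e₁ ≠ 0 := fun h => he₁0' (Subtype.ext h)
  have hce₀W : conj e₀ ∈ Module.End.eigenspace F (starRingEnd ℂ (μ 0)) := by
    rw [← EndAction.complexConj_eigenspace_baseChange, mem_complexConj, conj_conj]; exact he₀.1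
  have hce₁W : conj e₁ ∈ Module.End.eigenspace F (starRingEnd ℂ (μ 0)) := by
    rw [← EndAction.complexConj_eigenspace_baseChange, mem_complexConj, conj_conj]; exact he₁.1
  have hr₀ : ψC e₀ (conj e₀) ≠ 0 := ψ.form_conj_ne_zero (by norm_num) he₀.2 he₀0
  have hr₁ : ψC e₁ (conj e₁) ≠ 0 := ψ.form_conj_ne_zero (by norm_num) he₁.2 he₁0
  set f₀ := (ψC e₀ (conj e₀))⁻¹ • conj e₀ with hf₀
  set f₁ := (ψC e₁ (conj e₁))⁻¹ • conj e₁ with hf₁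
  have hf₀W : f₀ ∈ Module.End.eigenspace F (starRingEnd ℂ (μ 0)) := Submodule.smul_mem _ _ hce₀W
  have hf₁W : f₁ ∈ Module.End.eigenspace F (starRingEnd ℂ (μ 0)) := Submodule.smul_mem _ _ hce₁W
  have hf₀01 : f₀ ∈ H.piece 0 1 := Submodule.smul_mem _ _ (H.conj_mem_piece he₀.2)
  have hf₁10 : f₁ ∈ H.piece 1 0 := Submodule.smul_mem _ _ (H.conj_mem_piece he₁.2)
  have he₀f₀ : ψC e₀ f₀ = 1 := by rw [hf₀, map_smul, smul_eq_mul, inv_mul_cancel₀ hr₀]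
  have he₁f₁ : ψC e₁ f₁ = 1 := by rw [hf₁, map_smul, smul_eq_mul, inv_mul_cancel₀ hr₁]
  have he₀f₁ : ψC e₀ f₁ = 0 := h1100 e₀ he₀.2 f₁ hf₁10
  have he₁f₀ : ψC e₁ f₀ = 0 := h0101 e₁ he₁.2 f₀ hf₀01
  -- colour `1`: a basis of the plane `W(μ 1) = W(μ 1) ∩ V^{1,0}` and its dual basis of `W(conj μ 1) ⊆ V^{0,1}`
  set P₁ := Module.End.eigenspace F (μ 1) ⊓ H.piece 1 0 with hP₁
  set P₁' := Module.End.eigenspace F (starRingEnd ℂ (μ 1)) ⊓ H.piece 0 1 with hP₁'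
  set b : Module.Basis (Fin 2) ℂ ↥P₁ := Module.finBasisOfFinrankEq ℂ ↥P₁ h2a with hbdef
  set Φ := LinearEquiv.ofBijective _ (QuarticTheta.pairing_bijective H rfl ψ φ (μ 1) 1 0 (by norm_num)) with hΦdef
  have hΦ : ∀ (y' : ↥P₁') (x : ↥P₁), Φ y' x = ψC x y' := fun y' x => by
    rw [hΦdef, LinearEquiv.ofBijective_apply, LinearMap.flip_apply, LinearMap.domRestrict₁₂_apply]
  set fb : Module.Basis (Fin 2) ℂ ↥P₁' := b.dualBasis.map Φ.symm with hfbdef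
  have hfb : ∀ i (x : ↥P₁), ψC x (fb i) = b.repr x i := fun i x => by
    rw [← hΦ, hfbdef, Module.Basis.map_apply, LinearEquiv.apply_symm_apply, Module.Basis.dualBasis_apply]
  have hbfb : ∀ i j, ψC (b i) (fb j) = if i = j then 1 else 0 := fun i j => by
    rw [hfb, Module.Basis.repr_self, Finsupp.single_apply]
  -- the vector / covector families per colour
  set E0 : Fin 2 → ℂ ⊗[ℚ] V := ![e₀, e₁] with hE0
  set F0 : Fin 2 → ℂ ⊗[ℚ] V := ![f₀, f₁] with hF0
  set E1 : Fin 2 → ℂ ⊗[ℚ] V := fun ℓ => (b ℓ : ℂ ⊗[ℚ] V) with hE1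
  set F1 : Fin 2 → ℂ ⊗[ℚ] V := fun ℓ => (fb ℓ : ℂ ⊗[ℚ] V) with hF1
  set Ef : Fin 2 → Fin 2 → ℂ ⊗[ℚ] V := fun k => if k = 0 then E0 else E1 with hEf
  set Ff : Fin 2 → Fin 2 → ℂ ⊗[ℚ] V := fun k => if k = 0 then F0 else F1 with hFf
  have hEf0 : Ef 0 = E0 := by simp [hEf]
  have hEf1 : Ef 1 = E1 := by simp [hEf]
  have hFf0 : Ff 0 = F0 := by simp [hFf]
  have hFf1 : Ff 1 = F1 := by simp [hFf]
  -- eigenspace membership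
  have hEW : ∀ k ℓ, Ef k ℓ ∈ Module.End.eigenspace F (μ k) := by
    intro k ℓ
    rcases QuarticTheta.fin2_cases k with rfl | rfl
    · rw [hEf0]
      rcases QuarticTheta.fin2_cases ℓ with rfl | rfl
      · simp only [hE0, Matrix.cons_val_zero]; exact he₀.1
      · simp only [hE0, Matrix.cons_val_one, Matrix.cons_val_fin_one]; exact he₁.1
    · rw [hEf1]; exact (b ℓ).2.1
  have hFW : ∀ k ℓ, Ff k ℓ ∈ Module.End.eigenspace F (starRingEnd ℂ (μ k)) := by
    intro k ℓ
    rcases QuarticTheta.fin2_cases k with rfl | rfl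
    · rw [hFf0]
      rcases QuarticTheta.fin2_cases ℓ with rfl | rfl
      · simp only [hF0, Matrix.cons_val_zero]; exact hf₀W
      · simp only [hF0, Matrix.cons_val_one, Matrix.cons_val_fin_one]; exact hf₁W
    · rw [hFf1]; exact (fb ℓ).2.1
  -- kinds
  set κ : Fin 2 × Fin 2 → Fin 2 := fun kl => if kl.1 = 0 then kl.2 else 0 with hκ
  have hkind0 : ∀ k ℓ, κ (k, ℓ) = 0 → Ef k ℓ ∈ H.piece 1 0 ∧ Ff k ℓ ∈ H.piece 0 1 := by
    intro k ℓ h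
    rcases QuarticTheta.fin2_cases k with rfl | rfl
    · have hℓ : ℓ = 0 := by simpa [hκ] using h
      subst hℓ
      rw [hEf0, hFf0]
      simp only [hE0, hF0, Matrix.cons_val_zero]
      exact ⟨he₀.2, hf₀01⟩
    · rw [hEf1, hFf1]
      exact ⟨(b ℓ).2.2, (fb ℓ).2.2⟩
  have hkind1 : ∀ k ℓ, κ (k, ℓ) = 1 → Ef k ℓ ∈ H.piece 0 1 ∧ Ff k ℓ ∈ H.piece 1 0 := by
    intro k ℓ h
    rcases QuarticTheta.fin2_cases k with rfl | rfl
    · have hℓ : ℓ = 1 := by simpa [hκ] using h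
      subst hℓ
      rw [hEf0, hFf0]
      simp only [hE0, hF0, Matrix.cons_val_one, Matrix.cons_val_fin_one]
      exact ⟨he₁.2, hf₁10⟩
    · simp [hκ] at h
  -- non-vanishing of the four eigenspaces
  have hne : ∀ k, Module.End.eigenspace F (μ k) ≠ ⊥ := by
    intro k
    rcases QuarticTheta.fin2_cases k with rfl | rfl
    · exact fun h => he₀0 ((Submodule.mem_bot ℂ).1 (h ▸ he₀.1))
    · intro h
      have h0 : (b 0 : ℂ ⊗[ℚ] V) = 0 := (Submodule.mem_bot ℂ).1 (h ▸ (b 0).2.1)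
      exact b.ne_zero 0 (Subtype.ext h0)
  have hne' : ∀ k, Module.End.eigenspace F (starRingEnd ℂ (μ k)) ≠ ⊥ := fun k =>
    QuarticTheta.eigenspace_conj_ne_bot φ (hne k)
  -- the pairing table
  have horth : ∀ {a c : ℂ}, a ≠ starRingEnd ℂ c → Module.End.eigenspace F c ≠ ⊥ → ∀ {x y : ℂ ⊗[ℚ] V},
      x ∈ Module.End.eigenspace F a → y ∈ Module.End.eigenspace F c → ψC x y = 0 :=
    fun hac hc _ _ hx hy => QuarticTheta.form_eq_zero_of_ne H rfl heff ψ hφE hE hΘ hΘφ hac hc hx hy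
  have hμne : ∀ k k', μ k ≠ starRingEnd ℂ (μ k') := by
    intro k k'
    rcases QuarticTheta.fin2_cases k with rfl | rfl <;> rcases QuarticTheta.fin2_cases k' with rfl | rfl
    · exact h11.symm
    · exact fun h => h12' (by rw [h, starRingEnd_self_apply])
    · exact h12'
    · exact h22.symm
  have hEE : ∀ k k' i j, ψC (Ef k i) (Ef k' j) = 0 := fun k k' i j =>
    horth (hμne k k') (hne k') (hEW k i) (hEW k' j)
  have hFF : ∀ k k' i j, ψC (Ff k i) (Ff k' j) = 0 := fun k k' i j =>
    horth (by rw [hcc]; exact fun h => hμne k' k h.symm) (hne' k') (hFW k i) (hFW k' j)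
  have hEF : ∀ k k' i j, ψC (Ef k i) (Ff k' j) = if k = k' ∧ i = j then 1 else 0 := by
    intro k k' i j
    by_cases hkk : k = k'
    · subst hkk
      simp only [true_and]
      rcases QuarticTheta.fin2_cases k with rfl | rfl
      · rw [hEf0, hFf0]
        rcases QuarticTheta.fin2_cases i with rfl | rfl <;> rcases QuarticTheta.fin2_cases j with rfl | rfl <;>
          simp [hE0, hF0, he₀f₀, he₁f₁, he₀f₁, he₁f₀]
      · rw [hEf1, hFf1]
        exact hbfb i j
    · rw [if_neg (fun h => hkk h.1)]
      refine horth ?_ (hne' k') (hEW k i) (hFW k' j)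
      rw [hcc]
      intro h
      rcases QuarticTheta.fin2_cases k with rfl | rfl <;> rcases QuarticTheta.fin2_cases k' with rfl | rfl
      · exact hkk rfl
      · exact h12 h.symm
      · exact h12 h
      · exact hkk rfl
  have hFE : ∀ k k' i j, ψC (Ff k i) (Ef k' j) = -(if k' = k ∧ j = i then 1 else 0) := fun k k' i j => by
    rw [hswap, hEF]
  -- the combined family
  set cbf : (Fin 2 × Fin 2) × Fin 2 → ℂ ⊗[ℚ] V := fun x => if x.1.2 = 0 then Ef x.1.1 x.2 else Ff x.1.1 x.2
    with hcbf
  have hcbf0 : ∀ k ℓ, cbf ((k, 0), ℓ) = Ef k ℓ := fun k ℓ => by simp [hcbf]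
  have hcbf1 : ∀ k ℓ, cbf ((k, 1), ℓ) = Ff k ℓ := fun k ℓ => by simp [hcbf]
  -- linear independence by the pairing table
  have hli : LinearIndependent ℂ cbf := by
    rw [Fintype.linearIndependent_iff]
    intro c hc
    have hsum : ∑ x, c x • cbf x = ∑ k, ∑ ℓ, (c ((k, 0), ℓ) • Ef k ℓ + c ((k, 1), ℓ) • Ff k ℓ) := by
      rw [Fintype.sum_prod_type, Fintype.sum_prod_type]
      refine Finset.sum_congr rfl fun k _ => ?_
      rw [Fin.sum_univ_two, ← Finset.sum_add_distrib]
      simp only [hcbf0, hcbf1]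
    rw [hsum] at hc
    have hδ : ∀ (k' j : Fin 2) (g : Fin 2 × Fin 2 → ℂ),
        ∑ k, ∑ ℓ, g (k, ℓ) * (if k = k' ∧ ℓ = j then (1 : ℂ) else 0) = g (k', j) := by
      intro k' j g
      rw [Finset.sum_eq_single k' (fun k _ hk => Finset.sum_eq_zero fun ℓ _ => by
        rw [if_neg (fun h => hk h.1), mul_zero]) (fun h => absurd (Finset.mem_univ _) h),
        Finset.sum_eq_single j (fun ℓ _ hℓ => by rw [if_neg (fun h => hℓ h.2), mul_zero])
        (fun h => absurd (Finset.mem_univ _) h), if_pos ⟨rfl, rfl⟩, mul_one]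
    rintro ⟨⟨k', t⟩, j⟩
    rcases QuarticTheta.fin2_cases t with rfl | rfl
    · have h := congrArg (fun z => ψC z (Ff k' j)) hc
      simp only [map_sum, map_add, map_smul, LinearMap.sum_apply, LinearMap.add_apply, LinearMap.smul_apply,
        smul_eq_mul, hEF, hFF, mul_zero, add_zero, map_zero, LinearMap.zero_apply] at h
      rwa [hδ k' j (fun kl => c ((kl.1, 0), kl.2))] at h
    · have h := congrArg (fun z => ψC z (Ef k' j)) hc
      simp only [map_sum, map_add, map_smul, LinearMap.sum_apply, LinearMap.add_apply, LinearMap.smul_apply,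
        smul_eq_mul, hEE, hFE, mul_zero, zero_add, map_zero, LinearMap.zero_apply, mul_neg,
        Finset.sum_neg_distrib, neg_eq_zero] at h
      have h' : ∑ k, ∑ ℓ, c ((k, 1), ℓ) * (if k = k' ∧ ℓ = j then (1 : ℂ) else 0) = 0 := by
        refine Eq.trans (Finset.sum_congr rfl fun k _ => Finset.sum_congr rfl fun ℓ _ => ?_) h
        congr 1
        by_cases hkl : k = k' ∧ ℓ = j
        · rw [if_pos hkl, if_pos ⟨hkl.1.symm, hkl.2.symm⟩]
        · rw [if_neg hkl, if_neg (fun h'' => hkl ⟨h''.1.symm, h''.2.symm⟩)]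
      rwa [hδ k' j (fun kl => c ((kl.1, 1), kl.2))] at h'
  -- spanning: `V_ℂ = ⊕ W_c`, each `W_c` graded, the graded pieces spanned by the families
  have hspan : ⊤ ≤ Submodule.span ℂ (Set.range cbf) := by
    have hmemE : ∀ k ℓ, Ef k ℓ ∈ Submodule.span ℂ (Set.range cbf) := fun k ℓ => by
      rw [← hcbf0]; exact Submodule.subset_span ⟨_, rfl⟩
    have hmemF : ∀ k ℓ, Ff k ℓ ∈ Submodule.span ℂ (Set.range cbf) := fun k ℓ => by
      rw [← hcbf1]; exact Submodule.subset_span ⟨_, rfl⟩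
    -- the one-dimensional pieces of colour `0`
    have hline : ∀ (S : Submodule ℂ (ℂ ⊗[ℚ] V)) (v : ℂ ⊗[ℚ] V), v ∈ S → v ≠ 0 → Module.finrank ℂ S = 1 →
        v ∈ Submodule.span ℂ (Set.range cbf) → ∀ s ∈ S, s ∈ Submodule.span ℂ (Set.range cbf) := by
      intro S v hv hv0 hS hvmem s hs
      obtain ⟨a, ha⟩ := (finrank_eq_one_iff_of_nonzero' (⟨v, hv⟩ : S) (fun h => hv0 (congrArg Subtype.val h))).1
        hS ⟨s, hs⟩
      have hs' : s = a • v := by simpa using congrArg Subtype.val ha.symm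
      rw [hs']
      exact Submodule.smul_mem _ _ hvmem
    have hd01 : Module.finrank ℂ ↥(Module.End.eigenspace F (starRingEnd ℂ (μ 0)) ⊓ H.piece 0 1) = 1 := by
      rw [hF, ← starRingEnd_self_apply (μ 0), ← EndAction.complexConj_eigenspace_baseChange, starRingEnd_self_apply,
        ← complexConj_piece H 1 0, ← complexConj_inf, finrank_complexConj, h1a]
    have hd10 : Module.finrank ℂ ↥(Module.End.eigenspace F (starRingEnd ℂ (μ 0)) ⊓ H.piece 1 0) = 1 := by
      rw [hF, ← starRingEnd_self_apply (μ 0), ← EndAction.complexConj_eigenspace_baseChange, starRingEnd_self_apply,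
        ← complexConj_piece H 0 1, ← complexConj_inf, finrank_complexConj, h1b]
    have hf₀0 : f₀ ≠ 0 := fun h => by rw [h, map_zero] at he₀f₀; exact zero_ne_one he₀f₀
    have hf₁0 : f₁ ≠ 0 := fun h => by rw [h, map_zero] at he₁f₁; exact zero_ne_one he₁f₁
    have hE00 : Ef 0 0 = e₀ := by rw [hEf0]; simp [hE0]
    have hE01 : Ef 0 1 = e₁ := by rw [hEf0]; simp [hE0]
    have hF00 : Ff 0 0 = f₀ := by rw [hFf0]; simp [hF0]
    have hF01 : Ff 0 1 = f₁ := by rw [hFf0]; simp [hF0]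
    -- graded decomposition of each eigenspace
    have hgr : ∀ c, ∀ w ∈ Module.End.eigenspace F c,
        (2 : ℂ)⁻¹ • (w + Θ w) ∈ Module.End.eigenspace F c ⊓ H.piece 1 0 ∧
        (2 : ℂ)⁻¹ • (w - Θ w) ∈ Module.End.eigenspace F c ⊓ H.piece 0 1 ∧
        w = (2 : ℂ)⁻¹ • (w + Θ w) + (2 : ℂ)⁻¹ • (w - Θ w) := fun c w hw =>
      ⟨⟨Submodule.smul_mem _ _ (Submodule.add_mem _ hw (hΘW c w hw)), hP w⟩,
        ⟨Submodule.smul_mem _ _ (Submodule.sub_mem _ hw (hΘW c w hw)), hQ w⟩, by module⟩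
    have hWmem : ∀ c, (∀ s ∈ Module.End.eigenspace F c ⊓ H.piece 1 0, s ∈ Submodule.span ℂ (Set.range cbf)) →
        (∀ s ∈ Module.End.eigenspace F c ⊓ H.piece 0 1, s ∈ Submodule.span ℂ (Set.range cbf)) →
        ∀ w ∈ Module.End.eigenspace F c, w ∈ Submodule.span ℂ (Set.range cbf) := by
      intro c h10 h01 w hw
      obtain ⟨hPw, hQw, hw'⟩ := hgr c w hw
      rw [hw']
      exact Submodule.add_mem _ (h10 _ hPw) (h01 _ hQw)
    have hW0 := hWmem (μ 0) (hline _ e₀ he₀ he₀0 h1a (hE00 ▸ hmemE 0 0)) (hline _ e₁ he₁ he₁0 h1b (hE01 ▸ hmemE 0 1))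
    have hW0' := hWmem (starRingEnd ℂ (μ 0)) (hline _ f₁ ⟨hf₁W, hf₁10⟩ hf₁0 hd10 (hF01 ▸ hmemF 0 1))
      (hline _ f₀ ⟨hf₀W, hf₀01⟩ hf₀0 hd01 (hF00 ▸ hmemF 0 0))
    have hW1 : ∀ w ∈ Module.End.eigenspace F (μ 1), w ∈ Submodule.span ℂ (Set.range cbf) := by
      intro w hw
      have hw' : w ∈ P₁ := ⟨hw, hW₂10 hw⟩
      have h := congrArg Subtype.val (b.sum_repr ⟨w, hw'⟩)
      simp only [Submodule.coe_sum, Submodule.coe_smul] at h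
      rw [← h]
      exact Submodule.sum_mem _ fun i _ => Submodule.smul_mem _ _ (by
        have hm := hmemE 1 i
        rw [hEf1] at hm
        exact hm)
    have hW₂'01 : Module.End.eigenspace F (starRingEnd ℂ (μ 1)) ≤ H.piece 0 1 := by
      intro w hw
      rw [hF, ← EndAction.complexConj_eigenspace_baseChange, mem_complexConj] at hw
      have h := H.conj_mem_piece (hW₂10 hw)
      rwa [conj_conj] at h
    have hW1' : ∀ w ∈ Module.End.eigenspace F (starRingEnd ℂ (μ 1)), w ∈ Submodule.span ℂ (Set.range cbf) := by
      intro w hw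
      have hw' : w ∈ P₁' := ⟨hw, hW₂'01 hw⟩
      have h := congrArg Subtype.val (fb.sum_repr ⟨w, hw'⟩)
      simp only [Submodule.coe_sum, Submodule.coe_smul] at h
      rw [← h]
      exact Submodule.sum_mem _ fun i _ => Submodule.smul_mem _ _ (by
        have hm := hmemF 1 i
        rw [hFf1] at hm
        exact hm)
    rintro v -
    have hv : v ∈ Module.End.eigenspace F (μ 0) ⊔ Module.End.eigenspace F (starRingEnd ℂ (μ 0)) ⊔
        Module.End.eigenspace F (μ 1) ⊔ Module.End.eigenspace F (starRingEnd ℂ (μ 1)) := htop ▸ Submodule.mem_top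
    obtain ⟨u, hu, v₄, hv₄, rfl⟩ := Submodule.mem_sup.1 hv
    obtain ⟨u', hu', v₃, hv₃, rfl⟩ := Submodule.mem_sup.1 hu
    obtain ⟨v₁, hv₁, v₂, hv₂, rfl⟩ := Submodule.mem_sup.1 hu'
    exact Submodule.add_mem _ (Submodule.add_mem _ (Submodule.add_mem _ (hW0 v₁ hv₁) (hW0' v₂ hv₂)) (hW1 v₃ hv₃))
      (hW1' v₄ hv₄)
  refine ⟨Module.Basis.mk hli hspan, κ, fun k ℓ => ?_, fun k ℓ => ?_, fun k ℓ h => ?_, fun k ℓ h => ?_,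
    fun k k' i j => ?_, fun k k' t i j => ?_⟩
  · rw [Module.Basis.mk_apply, hcbf0]; exact hEW k ℓ
  · rw [Module.Basis.mk_apply, hcbf1]; exact hFW k ℓ
  · rw [Module.Basis.mk_apply, Module.Basis.mk_apply, hcbf0, hcbf1]; exact hkind0 k ℓ h
  · rw [Module.Basis.mk_apply, Module.Basis.mk_apply, hcbf0, hcbf1]; exact hkind1 k ℓ h
  · rw [Module.Basis.mk_apply, Module.Basis.mk_apply, hcbf0, hcbf1]; exact hEF k k' i j
  · rw [Module.Basis.mk_apply, Module.Basis.mk_apply]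
    rcases QuarticTheta.fin2_cases t with rfl | rfl
    · rw [hcbf0, hcbf0]; exact hEE k k' i j
    · rw [hcbf1, hcbf1]; exact hFF k k' i j

end QuarticDualBases

end HodgeStructure

end Literature.AlgebraicGeometry.Motives


/-! ### §3 The invariance theorem: slices are killed by `𝔤𝔩(W_{μ₁}) × 𝔤𝔩(W_{μ₂})` acting by `X ⊕ (-Xᵀ)` on its colour -/

namespace Literature.AlgebraicGeometry.HodgeTheory

open Literature.AlgebraicTopology.SingularHomology
open Literature.AlgebraicGeometry.Motives (IsSmoothProjective AbelianVariety bettiCohomology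
  ofRatClassBaseChange ofRatClassBaseChange_tmul HodgeTensorFacts hodgeTensorFacts_holds)
open Literature.Barriers.HodgeConjecture
open Literature.AlgebraicGeometry.Motives.HodgeStructure
open Literature.RepresentationTheory.GeneralLinear
open Literature.RepresentationTheory.ClassicalInvariants
open Literature.NumberTheory.DiophantineGeometry

section QuarticInvariance

variable {A B : AbelianVariety ℂ} {n : ℕ} {g : Fin n → (B ⟶ A)}

/-- The two elements of `Fin 2`. [folklore] -/
private theorem fin2_cases'' (r : Fin 2) : r = 0 ∨ r = 1 := by
  fin_cases r <;> simp

open scoped Classical in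
/-- **THE INVARIANCE THEOREM (Moonen–Zarhin 1999 Thm. (0.2)(4), Lie step, for abelian varieties with slots over a
simple Type IV(2,1) `A` of signature `{(1,1),(2,0)}`).** Let `A` be a complex abelian variety whose
`H = H¹(A(ℂ); ℚ)` carries a polarization `ψ` and a quartic CM structure `φ ∈ End_Hdg(H)` as in
`HodgeStructure.QuarticTheta.mem_spanC_of_commute_of_skew` (eigenvalues `μ 0, μ 1`), let `cb` be adapted
`ψ_ℂ`-dual bases (`exists_adaptedDualBasis`), and `B` an abelian variety with slots `g` over `A`. Then every
rational `(p,p)`-class `c` on `B` (`p ≥ 1`) is `∑_w a(w) · (g cb)_w` for a coefficient function `a` on words in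
the letters `((j, (k, t)), ℓ)` (slot, colour, type, index) such that for every slot-colour-type word `U`, every
colour `k` and EVERY `X ∈ 𝔤𝔩_{n₀}(ℂ)` the typed differential of `X` at the positions of colour `k` (`X` at type
`0`, `-Xᵀ` at type `1`, `0` at the other colour) kills the slice `a(U, −)`: the operator `Y_{k,X}` of `H_ℂ` with
this block matrix in the letters commutes with `φ_ℂ` (blockwise scalars) and is `ψ_ℂ`-skew (the pairing table),
so THEOREM L″ (`HodgeStructure.QuarticTheta.wordDerAt_eq_zero_of_commute_of_skew`) applies; the transport between
adapted and rational letters is that of the tree's `AVSlots.exists_unitaryInvariant_coeff`.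
[cite: MoonenZarhin1999LowDim, Thm. (0.2)(4) and §3 (3.1)] [cite: Gordon1997, §6 (proof of Thm. 6.3.3, pp. 18–19)]
[cite: Milne1999LefschetzClasses, §2 p. 651] -/
theorem AVSlots.exists_quarticInvariant_coeff [HodgeTensorFacts.{0, 0}] (hg : AVSlots A B g)
    (hHD : exists_isReal_hodgeModel) (hI : hodgePQ_independent_of_hodgeModel)
    (ψ : (BettiUniverse.hodge hHD (AbelianVariety.isSmoothProjective_holds (A := A)) 1).Polarization)
    {φ : Module.End ℚ (bettiCohomology A.X 1)}
    (hφE : φ ∈ (BettiUniverse.hodge hHD (AbelianVariety.isSmoothProjective_holds (A := A)) 1).endAlg)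
    (hE : ∀ a ∈ (BettiUniverse.hodge hHD (AbelianVariety.isSmoothProjective_holds (A := A)) 1).endAlg,
      ∃ q : Fin 4 → ℚ, a = ∑ k, q k • φ ^ (k : ℕ))
    (hdiv : ∀ a ∈ (BettiUniverse.hodge hHD (AbelianVariety.isSmoothProjective_holds (A := A)) 1).endAlg,
      a ≠ 0 → ∃ b : Module.End ℚ (bettiCohomology A.X 1), b * a = 1)
    (μ : Fin 2 → ℂ) (h11 : starRingEnd ℂ (μ 0) ≠ μ 0) (h22 : starRingEnd ℂ (μ 1) ≠ μ 1) (h12 : μ 1 ≠ μ 0)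
    (h12' : μ 1 ≠ starRingEnd ℂ (μ 0)) (hV : Module.finrank ℚ (bettiCohomology A.X 1) = 8)
    (h1a : Module.finrank ℂ ↥(Module.End.eigenspace (φ.baseChange ℂ) (μ 0) ⊓
      (BettiUniverse.hodge hHD (AbelianVariety.isSmoothProjective_holds (A := A)) 1).piece 1 0) = 1)
    (h1b : Module.finrank ℂ ↥(Module.End.eigenspace (φ.baseChange ℂ) (μ 0) ⊓
      (BettiUniverse.hodge hHD (AbelianVariety.isSmoothProjective_holds (A := A)) 1).piece 0 1) = 1)
    (h2a : Module.finrank ℂ ↥(Module.End.eigenspace (φ.baseChange ℂ) (μ 1) ⊓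
      (BettiUniverse.hodge hHD (AbelianVariety.isSmoothProjective_holds (A := A)) 1).piece 1 0) = 2)
    {n₀ : ℕ} (cb : Module.Basis ((Fin 2 × Fin 2) × Fin n₀) ℂ (ℂ ⊗[ℚ] bettiCohomology A.X 1))
    (κ : Fin 2 × Fin n₀ → Fin 2)
    (hcbW : ∀ k ℓ, cb ((k, 0), ℓ) ∈ Module.End.eigenspace (φ.baseChange ℂ) (μ k))
    (hcbW' : ∀ k ℓ, cb ((k, 1), ℓ) ∈ Module.End.eigenspace (φ.baseChange ℂ) (starRingEnd ℂ (μ k)))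
    (hcb0 : ∀ k ℓ, κ (k, ℓ) = 0 →
      cb ((k, 0), ℓ) ∈ (BettiUniverse.hodge hHD (AbelianVariety.isSmoothProjective_holds (A := A)) 1).piece 1 0 ∧
      cb ((k, 1), ℓ) ∈ (BettiUniverse.hodge hHD (AbelianVariety.isSmoothProjective_holds (A := A)) 1).piece 0 1)
    (hcb1 : ∀ k ℓ, κ (k, ℓ) = 1 →
      cb ((k, 0), ℓ) ∈ (BettiUniverse.hodge hHD (AbelianVariety.isSmoothProjective_holds (A := A)) 1).piece 0 1 ∧
      cb ((k, 1), ℓ) ∈ (BettiUniverse.hodge hHD (AbelianVariety.isSmoothProjective_holds (A := A)) 1).piece 1 0)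
    (hdual : ∀ k k' i j, ψ.form.baseChange ℂ (cb ((k, 0), i)) (cb ((k', 1), j)) =
      if k = k' ∧ i = j then 1 else 0)
    (hiso : ∀ k k' (t : Fin 2) i j, ψ.form.baseChange ℂ (cb ((k, t), i)) (cb ((k', t), j)) = 0)
    {p : ℕ} (hp : 0 < p) {c : complexBetti B.X (2 * p)} (hcQ : IsRationalClass c)
    (hc : IsOfHodgeType B.dim B.X (2 * p) p p c) :
    ∃ a : (Fin (2 * p) → (Fin n × (Fin 2 × Fin 2)) × Fin n₀) → ℂ,
      wordEval (cupPowOneAlt ℂ (Motives.ComplexPoints B.X) (2 * p))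
        (fun x : (Fin n × (Fin 2 × Fin 2)) × Fin n₀ => avLetters g (fun tl : (Fin 2 × Fin 2) × Fin n₀ =>
          ofRatClassBaseChange (Motives.ComplexPoints A.X) 1 (cb tl)) (x.1.1, (x.1.2, x.2))) a = c ∧
      ∀ (U : Fin (2 * p) → Fin n × (Fin 2 × Fin 2)) (k : Fin 2) (X : Matrix (Fin n₀) (Fin n₀) ℂ),
        wordDerAt ℂ (fun t => if (U t).2.1 = k then (if (U t).2.2 = 0 then X else -Xᵀ) else 0)
          (wordSlice a U) = 0 := by
  classical
  -- the setting
  have hX : IsSmoothProjective A.dim A.X := AbelianVariety.isSmoothProjective_holds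
  haveI : Module.Finite ℚ (bettiCohomology A.X 1) := finite_bettiCohomology_one A
  have hn1 : (((1 : ℕ) : ℤ)) = 1 := Nat.cast_one
  have heff := BettiUniverse.hodge_isEffective hHD hX 1
  set F := cupPowOneAlt ℂ (Motives.ComplexPoints B.X) (2 * p) with hFdef
  have hFinj : Function.Injective (exteriorPower.alternatingMapLinearEquiv F) :=
    injective_alternatingMapLinearEquiv_cupPowOneAlt B (2 * p)
  -- bases: the adapted basis `cbσ` and the rational basis `eC`, both indexed by `Fin M`
  set eQ := Module.finBasis ℚ (bettiCohomology A.X 1) with heQ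
  set eC : Module.Basis (Fin (Module.finrank ℚ (bettiCohomology A.X 1))) ℂ
    (ℂ ⊗[ℚ] bettiCohomology A.X 1) := Algebra.TensorProduct.basis ℂ eQ with heC
  set φι : Fin (Module.finrank ℚ (bettiCohomology A.X 1)) ≃ (Fin 2 × Fin 2) × Fin n₀ := eC.indexEquiv cb with hφι
  set cbσ : Module.Basis (Fin (Module.finrank ℚ (bettiCohomology A.X 1))) ℂ
    (ℂ ⊗[ℚ] bettiCohomology A.X 1) := cb.reindex φι.symm with hcbσdef
  have hcbσ : ∀ m, cbσ m = cb (φι m) := fun m => by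
    rw [hcbσdef, Module.Basis.reindex_apply, Equiv.symm_symm]
  -- kinds of the adapted letters (covectors have the opposite kind)
  set κ2 : (Fin 2 × Fin 2) × Fin n₀ → Fin 2 := fun x =>
    if x.1.2 = 0 then κ (x.1.1, x.2) else (if κ (x.1.1, x.2) = 0 then 1 else 0) with hκ2
  have hkind : ∀ x : (Fin 2 × Fin 2) × Fin n₀,
      (κ2 x = 0 → cb x ∈ (BettiUniverse.hodge hHD (AbelianVariety.isSmoothProjective_holds (A := A)) 1).piece 1 0) ∧
      (κ2 x = 1 → cb x ∈ (BettiUniverse.hodge hHD (AbelianVariety.isSmoothProjective_holds (A := A)) 1).piece 0 1) := by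
    rintro ⟨⟨k, t⟩, ℓ⟩
    rcases fin2_cases'' t with rfl | rfl <;> rcases fin2_cases'' (κ (k, ℓ)) with h | h
    · have hk : κ2 ((k, 0), ℓ) = 0 := by simp [hκ2, h]
      rw [hk]
      exact ⟨fun _ => (hcb0 k ℓ h).1, fun h' => absurd h' (by decide)⟩
    · have hk : κ2 ((k, 0), ℓ) = 1 := by simp [hκ2, h]
      rw [hk]
      exact ⟨fun h' => absurd h' (by decide), fun _ => (hcb1 k ℓ h).1⟩
    · have hk : κ2 ((k, 1), ℓ) = 1 := by simp [hκ2, h]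
      rw [hk]
      exact ⟨fun h' => absurd h' (by decide), fun _ => (hcb0 k ℓ h).2⟩
    · have hk : κ2 ((k, 1), ℓ) = 0 := by simp [hκ2, h]
      rw [hk]
      exact ⟨fun _ => (hcb1 k ℓ h).2, fun h' => absurd h' (by decide)⟩
  set κ' : Fin (Module.finrank ℚ (bettiCohomology A.X 1)) → Fin 2 := fun m => κ2 (φι m) with hκ'
  -- letters
  set ρ := ofRatClassBaseChangeEquiv hX 1 with hρ
  set v : Module.Basis _ ℂ (complexBetti A.X 1) := cbσ.map ρ with hv
  set eL : Module.Basis _ ℂ (complexBetti A.X 1) := eC.map ρ with heL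
  have heLQ : ∀ i, IsRationalClass (eL i) := fun i => by
    rw [heL, Module.Basis.map_apply, heC, Algebra.TensorProduct.basis_apply, hρ,
      ofRatClassBaseChangeEquiv_apply, ofRatClassBaseChange_tmul, one_smul]
    exact isRationalClass_ofRatClass _
  have hv_apply : ∀ m, v m = ofRatClassBaseChange (Motives.ComplexPoints A.X) 1 (cb (φι m)) := fun m => by
    rw [hv, Module.Basis.map_apply, hcbσ, hρ, ofRatClassBaseChangeEquiv_apply]
  have hv0 : ∀ m, κ' m = 0 → IsOfHodgeType A.dim A.X 1 1 0 (v m) := by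
    intro m hm
    rw [hv_apply, ← BettiUniverse.mem_hodge_piece_iff hHD hI hX (k := 1) (p := 1) (q := 0) rfl]
    exact (hkind (φι m)).1 hm
  have hv1 : ∀ m, κ' m = 1 → IsOfHodgeType A.dim A.X 1 0 1 (v m) := by
    intro m hm
    rw [hv_apply, ← BettiUniverse.mem_hodge_piece_iff hHD hI hX (k := 1) (p := 0) (q := 1) rfl]
    exact (hkind (φι m)).2 hm
  -- (α) an antisymmetric kind-balanced coefficient function in the adapted letters
  obtain ⟨ax, hax_bal, hax_anti, hcax⟩ := hg.exists_antisymm_kindBalanced_wordEval_eq v κ' hv0 hv1 hp hc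
  -- the change of letters to the rational letters
  set G : Matrix _ _ ℂ := eC.toMatrix cbσ with hG
  set G' : Matrix _ _ ℂ := cbσ.toMatrix eC with hG'
  have hG'G : G' * G = 1 := cbσ.toMatrix_mul_toMatrix_flip eC
  have hve : ∀ m, v m = ∑ i, G i m • eL i := fun m => by
    simp only [hv, heL, Module.Basis.map_apply, ← map_smul, ← map_sum]
    congr 1
    exact (eC.sum_toMatrix_smul_self (v := ⇑cbσ) (j := m)).symm
  have hletters : ∀ j m, avLetters g v (j, m) = ∑ i, G i m • avLetters g eL (j, i) :=
    avLetters_baseChange g G hve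
  set aE := colourChangeAt (fun _ : Fin n => G) ax with haE
  have haE_anti : IsAntisymm aE := hax_anti.colourChangeAt _
  have hcaE : wordEval F (avLetters g eL) aE = c := by
    rw [haE, ← wordEval_eq_wordEval_colourChangeAt F (fun _ : Fin n => G) hletters ax, hcax]
  -- rationality of `aE`
  obtain ⟨q, hq⟩ := hg.exists_rat_wordEval_eq eL heLQ hcQ
  obtain ⟨q', -, haEq⟩ := haE_anti.exists_eq_algebraMap_of_wordEval_eq hFinj (hg.letterBasis eL)
    (q := q) (by rw [AVSlots.coe_letterBasis, hcaE, hFdef, hq])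
  have hslice_e : ∀ u, wordSlice aE u = wordRepAt ℂ (fun _ : Fin (2 * p) => G) (wordSlice ax u) :=
    fun u => wordSlice_colourChangeAt (fun _ : Fin n => G) ax u
  -- the Hodge operator `Θ`: `diag(±1)` in the adapted letters
  obtain ⟨Θ, hΘ⟩ := exists_hodgeTheta (BettiUniverse.hodge hHD (AbelianVariety.isSmoothProjective_holds (A := A)) 1)
  obtain ⟨-, -, hΘ10, hΘ01, -⟩ :=
    UnitaryTheta.theta_facts (BettiUniverse.hodge hHD (AbelianVariety.isSmoothProjective_holds (A := A)) 1)
      hn1 heff hΘ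
  have hΘb : ∀ m, Θ (cbσ m) = (if κ' m = 0 then (1 : ℂ) else -1) • cbσ m := by
    intro m
    rw [hcbσ]
    rcases fin2_cases'' (κ' m) with h0 | h1'
    · rw [h0, if_pos rfl, one_smul]
      exact hΘ10 _ ((hkind (φι m)).1 h0)
    · rw [h1', if_neg one_ne_zero, neg_one_smul]
      exact hΘ01 _ ((hkind (φι m)).2 h1')
  have hΘcb : LinearMap.toMatrix cbσ cbσ Θ = kindDiag κ' := by
    ext i m
    rw [LinearMap.toMatrix_apply, hΘb, map_smul, Module.Basis.repr_self, Finsupp.smul_apply,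
      Finsupp.single_apply, kindDiag, Matrix.diagonal_apply, smul_eq_mul, mul_ite, mul_one, mul_zero]
    by_cases him : i = m
    · subst him; rw [if_pos rfl]
    · rw [if_neg (Ne.symm him), if_neg him]
  have hJG : LinearMap.toMatrix eC eC Θ * G = G * kindDiag κ' := by
    rw [← hΘcb, hG, linearMap_toMatrix_mul_basis_toMatrix, basis_toMatrix_mul_linearMap_toMatrix]
  have hΘq : ∀ u : Fin (2 * p) → Fin n, wordDerAt ℂ (fun _ : Fin (2 * p) => LinearMap.toMatrix eC eC Θ)
      (wordSlice (fun w => algebraMap ℚ ℂ (q' w)) u) = 0 := by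
    intro u
    rw [← haEq, hslice_e]
    refine wordDerAt_wordRepAt_eq_zero_of_mul_eq ℂ (fun _ : Fin (2 * p) => G) (fun _ => hJG) ?_
    rw [wordDerAt_const]
    exact wordDer_kindDiag_wordSlice_eq_zero κ' hax_bal u
  -- structure constants of `ψ_ℂ` and `φ_ℂ` in the adapted basis
  set ψC := ψ.form.baseChange ℂ with hψC
  have hswap : ∀ x y, ψC y x = -ψC x y := fun x y => by
    rw [hψC, ψ.form_baseChange_swap, show (((1 : ℕ) : ℤ)).negOnePow = -1 from Int.negOnePow_one]
    simp
  have hdual_same : ∀ k i j, ψC (cb ((k, 0), i)) (cb ((k, 1), j)) = if i = j then 1 else 0 := fun k i j => by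
    rw [hψC, hdual]; simp
  have hswap_same : ∀ k i j, ψC (cb ((k, 1), i)) (cb ((k, 0), j)) = -(if j = i then 1 else 0) := fun k i j => by
    rw [hswap, hdual_same]
  have hpair0 : ∀ k₁ k₂ (t₁ t₂ : Fin 2) i j, k₁ ≠ k₂ → ψC (cb ((k₁, t₁), i)) (cb ((k₂, t₂), j)) = 0 := by
    intro k₁ k₂ t₁ t₂ i j hk
    rcases fin2_cases'' t₁ with rfl | rfl <;> rcases fin2_cases'' t₂ with rfl | rfl
    · exact hiso k₁ k₂ 0 i j
    · rw [hψC, hdual, if_neg (fun h => hk h.1)]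
    · rw [hswap, hψC, hdual, if_neg (fun h => hk h.1.symm), neg_zero]
    · exact hiso k₁ k₂ 1 i j
  set ev : Fin 2 × Fin 2 → ℂ := fun kt => if kt.2 = 0 then μ kt.1 else starRingEnd ℂ (μ kt.1) with hev
  have hφcb : ∀ (kt : Fin 2 × Fin 2) ℓ, φ.baseChange ℂ (cb (kt, ℓ)) = ev kt • cb (kt, ℓ) := by
    rintro ⟨k, t⟩ ℓ
    rcases fin2_cases'' t with rfl | rfl
    · simp only [hev, if_pos rfl]; exact Module.End.mem_eigenspace_iff.1 (hcbW k ℓ)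
    · simp only [hev, if_neg one_ne_zero]; exact Module.End.mem_eigenspace_iff.1 (hcbW' k ℓ)
  -- the invariance of every slice under the typed differentials of colour `k`, via THEOREM L″
  have key : ∀ (k : Fin 2) (X : Matrix (Fin n₀) (Fin n₀) ℂ) (u : Fin (2 * p) → Fin n),
      wordDerAt ℂ (fun _ : Fin (2 * p) => blockLiftGen φι (fun kt : Fin 2 × Fin 2 =>
        if kt.1 = k then (if kt.2 = 0 then X else -Xᵀ) else 0)) (wordSlice ax u) = 0 := by
    intro k X u
    set Nf : Fin 2 × Fin 2 → Matrix (Fin n₀) (Fin n₀) ℂ := fun kt =>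
      if kt.1 = k then (if kt.2 = 0 then X else -Xᵀ) else 0 with hNf
    have hNf0 : Nf (k, 0) = X := by simp [hNf]
    have hNf1 : Nf (k, 1) = -Xᵀ := by simp [hNf]
    have hNfne : ∀ k' t, k' ≠ k → Nf (k', t) = 0 := fun k' t hk' => by simp [hNf, hk']
    set Y := Matrix.toLin cbσ cbσ (blockLiftGen φι Nf) with hYdef
    have hYcb : ∀ (kt : Fin 2 × Fin 2) ℓ, Y (cb (kt, ℓ)) = ∑ r, Nf kt r ℓ • cb (kt, r) :=
      fun kt ℓ => toLin_blockLiftGen_apply φι cbσ (⇑cb) hcbσ Nf kt ℓ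
    have hYφ : Y * φ.baseChange ℂ = φ.baseChange ℂ * Y := by
      refine cb.ext fun x => ?_
      obtain ⟨kt, ℓ⟩ := x
      rw [Module.End.mul_apply, Module.End.mul_apply, hφcb, map_smul, hYcb, map_sum, Finset.smul_sum]
      exact Finset.sum_congr rfl fun r _ => by rw [map_smul, hφcb, smul_comm]
    have hYskew : ∀ x y, ψC (Y x) y + ψC x (Y y) = 0 := by
      have hB : ψC ∘ₗ Y + ψC.compl₂ Y = 0 := by
        refine LinearMap.BilinForm.ext_basis cb fun x₁ x₂ => ?_
        obtain ⟨⟨k₁, t₁⟩, i⟩ := x₁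
        obtain ⟨⟨k₂, t₂⟩, j⟩ := x₂
        rw [LinearMap.add_apply, LinearMap.add_apply, LinearMap.comp_apply, LinearMap.compl₂_apply,
          LinearMap.zero_apply, LinearMap.zero_apply, hYcb, hYcb, map_sum, LinearMap.sum_apply, map_sum]
        simp only [map_smul, LinearMap.smul_apply, smul_eq_mul]
        by_cases hk12 : k₁ = k₂
        · subst hk12
          by_cases hk1 : k₁ = k
          · subst hk1
            rcases fin2_cases'' t₁ with rfl | rfl <;> rcases fin2_cases'' t₂ with rfl | rfl
            · simp [hiso]
            · simp [hNf0, hNf1, hdual_same, Matrix.neg_apply, Matrix.transpose_apply, mul_ite, Finset.sum_ite_eq,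
                Finset.sum_ite_eq']
            · simp [hNf0, hNf1, hswap_same, Matrix.neg_apply, Matrix.transpose_apply, mul_ite, Finset.sum_ite_eq,
                Finset.sum_ite_eq']
            · simp [hiso]
          · simp [hNfne k₁ t₁ hk1, hNfne k₁ t₂ hk1]
        · simp [hpair0 k₁ k₂ t₁ t₂ _ _ hk12]
      intro x y
      have h := LinearMap.congr_fun (LinearMap.congr_fun hB x) y
      simpa only [LinearMap.add_apply, LinearMap.comp_apply, LinearMap.compl₂_apply, LinearMap.zero_apply]
        using h
    have hL := QuarticTheta.wordDerAt_eq_zero_of_commute_of_skew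
      (BettiUniverse.hodge hHD (AbelianVariety.isSmoothProjective_holds (A := A)) 1) hn1 heff ψ hφE hE hdiv
      h11 h22 h12 h12' hV h1a h1b h2a eQ q' hΘ hΘq hYφ hYskew u
    rw [← haEq, hslice_e] at hL
    have hYG : ∀ _t : Fin (2 * p), LinearMap.toMatrix eC eC Y * G = G * LinearMap.toMatrix cbσ cbσ Y :=
      fun _ => by rw [hG, linearMap_toMatrix_mul_basis_toMatrix, basis_toMatrix_mul_linearMap_toMatrix]
    have hblk : LinearMap.toMatrix cbσ cbσ Y = blockLiftGen φι Nf := by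
      rw [hYdef, LinearMap.toMatrix_toLin]
    have h3 : wordRepAt ℂ (fun _ : Fin (2 * p) => G)
        (wordDerAt ℂ (fun _ : Fin (2 * p) => blockLiftGen φι Nf) (wordSlice ax u)) = 0 := by
      rw [← hblk, wordRepAt_wordDerAt_of_mul_eq ℂ (fun _ : Fin (2 * p) => G) hYG, hL]
    exact wordRepAt_injective ℂ (g := fun _ : Fin (2 * p) => G) (g' := fun _ : Fin (2 * p) => G')
      (funext fun _ => hG'G) (by rw [h3, map_zero])
  -- the coefficient function, refined to slot-and-(colour, type) letters
  refine ⟨placeRefineGen φι ax, ?_, fun U k X => ?_⟩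
  · rw [← hcax]
    have hx : (fun x : (Fin n × (Fin 2 × Fin 2)) × Fin n₀ => avLetters g v (x.1.1, φι.symm (x.1.2, x.2))) =
        fun x => avLetters g (fun tl : (Fin 2 × Fin 2) × Fin n₀ =>
          ofRatClassBaseChange (Motives.ComplexPoints A.X) 1 (cb tl)) (x.1.1, (x.1.2, x.2)) := by
      funext x
      rw [avLetters_apply, avLetters_apply, hv_apply, Equiv.apply_symm_apply]
    rw [← hx]
    exact wordEval_placeRefineGen F φι (avLetters g v) ax
  · exact wordDerAt_placeRefineGen_eq_zero φι
      (fun kt : Fin 2 × Fin 2 => if kt.1 = k then (if kt.2 = 0 then X else -Xᵀ) else 0) (key k X) U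

end QuarticInvariance

/-! ### §4 The assembly: `Bᵖ(B) ⊆ Dᵖ(B) ⊗ ℂ` by the coloured unipotent bridge, the tensor FFT for `GL(W_{μ₁}) × GL(W_{μ₂})` and the crossed classes -/

section QuarticAssembly

variable {A B : AbelianVariety ℂ} {n : ℕ} {g : Fin n → (B ⟶ A)}

open scoped Classical in
/-- **`Bᵖ(B) ⊆ Dᵖ(B) ⊗ ℂ` for an abelian variety `B` with slots over `A` of quartic CM type `{(1,1),(2,0)}`**
(data as in `exists_quarticInvariant_coeff`), granted that the CROSSED CLASSES
`∑_ℓ g_j^* cb((k,0),ℓ) ⌣ g_{j'}^* cb((k,1),ℓ)` of two slots and one colour lie in `B¹(B) ⊗ ℂ` (`hcross`). Every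
rational `(p,p)`-class on `B` is a `ℂ`-combination of products of `p` rational `(1,1)`-classes: the slices of its
coefficient function are killed by `𝔤𝔩 × 𝔤𝔩` acting colourwise (`exists_quarticInvariant_coeff`), hence fixed by
`GL × GL` (coloured unipotent bridge, Goodman–Wallach Thm. 2.2.2), hence combinations of colour-preserving complete
contractions (tensor FFT for `GL(U₁) × GL(U₂)`, Goodman–Wallach Thm. 5.3.1 per colour,
`mem_span_contractionTensor_of_forall_wordDerAt_mixedLieFamilyAt_eq_zero`), each of which evaluates on the letters
to `±` a product of crossed classes of one colour each (`Milne1999.sum_contractionTensor_smul_eq`,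
`sum_cupPowOne_glPairWord_mem`: Milne Prop. 3.6 (c) "each of which is visibly a product of 2-forms"). MZ99
(0.2)(4): "`B(Xⁿ) = D(Xⁿ)` for all `n`". [cite: MoonenZarhin1999LowDim, Thm. (0.2)(4) and §3 (3.1)]
[cite: Milne1999LefschetzClasses, Prop. 3.6 (c) and Remark 3.7 (pp. 655–656)] [cite: GoodmanWallachGTM255, Thm. 2.2.2 and Thm. 5.3.1] -/
theorem AVSlots.quarticHodgeClasses_divisorial [HodgeTensorFacts.{0, 0}] (hg : AVSlots A B g)
    (hHD : exists_isReal_hodgeModel) (hI : hodgePQ_independent_of_hodgeModel)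
    (ψ : (BettiUniverse.hodge hHD (AbelianVariety.isSmoothProjective_holds (A := A)) 1).Polarization)
    {φ : Module.End ℚ (bettiCohomology A.X 1)}
    (hφE : φ ∈ (BettiUniverse.hodge hHD (AbelianVariety.isSmoothProjective_holds (A := A)) 1).endAlg)
    (hE : ∀ a ∈ (BettiUniverse.hodge hHD (AbelianVariety.isSmoothProjective_holds (A := A)) 1).endAlg,
      ∃ q : Fin 4 → ℚ, a = ∑ k, q k • φ ^ (k : ℕ))
    (hdiv : ∀ a ∈ (BettiUniverse.hodge hHD (AbelianVariety.isSmoothProjective_holds (A := A)) 1).endAlg,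
      a ≠ 0 → ∃ b : Module.End ℚ (bettiCohomology A.X 1), b * a = 1)
    (μ : Fin 2 → ℂ) (h11 : starRingEnd ℂ (μ 0) ≠ μ 0) (h22 : starRingEnd ℂ (μ 1) ≠ μ 1) (h12 : μ 1 ≠ μ 0)
    (h12' : μ 1 ≠ starRingEnd ℂ (μ 0)) (hV : Module.finrank ℚ (bettiCohomology A.X 1) = 8)
    (h1a : Module.finrank ℂ ↥(Module.End.eigenspace (φ.baseChange ℂ) (μ 0) ⊓
      (BettiUniverse.hodge hHD (AbelianVariety.isSmoothProjective_holds (A := A)) 1).piece 1 0) = 1)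
    (h1b : Module.finrank ℂ ↥(Module.End.eigenspace (φ.baseChange ℂ) (μ 0) ⊓
      (BettiUniverse.hodge hHD (AbelianVariety.isSmoothProjective_holds (A := A)) 1).piece 0 1) = 1)
    (h2a : Module.finrank ℂ ↥(Module.End.eigenspace (φ.baseChange ℂ) (μ 1) ⊓
      (BettiUniverse.hodge hHD (AbelianVariety.isSmoothProjective_holds (A := A)) 1).piece 1 0) = 2)
    {n₀ : ℕ} (cb : Module.Basis ((Fin 2 × Fin 2) × Fin n₀) ℂ (ℂ ⊗[ℚ] bettiCohomology A.X 1))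
    (κ : Fin 2 × Fin n₀ → Fin 2)
    (hcbW : ∀ k ℓ, cb ((k, 0), ℓ) ∈ Module.End.eigenspace (φ.baseChange ℂ) (μ k))
    (hcbW' : ∀ k ℓ, cb ((k, 1), ℓ) ∈ Module.End.eigenspace (φ.baseChange ℂ) (starRingEnd ℂ (μ k)))
    (hcb0 : ∀ k ℓ, κ (k, ℓ) = 0 →
      cb ((k, 0), ℓ) ∈ (BettiUniverse.hodge hHD (AbelianVariety.isSmoothProjective_holds (A := A)) 1).piece 1 0 ∧
      cb ((k, 1), ℓ) ∈ (BettiUniverse.hodge hHD (AbelianVariety.isSmoothProjective_holds (A := A)) 1).piece 0 1)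
    (hcb1 : ∀ k ℓ, κ (k, ℓ) = 1 →
      cb ((k, 0), ℓ) ∈ (BettiUniverse.hodge hHD (AbelianVariety.isSmoothProjective_holds (A := A)) 1).piece 0 1 ∧
      cb ((k, 1), ℓ) ∈ (BettiUniverse.hodge hHD (AbelianVariety.isSmoothProjective_holds (A := A)) 1).piece 1 0)
    (hdual : ∀ k k' i j, ψ.form.baseChange ℂ (cb ((k, 0), i)) (cb ((k', 1), j)) =
      if k = k' ∧ i = j then 1 else 0)
    (hiso : ∀ k k' (t : Fin 2) i j, ψ.form.baseChange ℂ (cb ((k, t), i)) (cb ((k', t), j)) = 0)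
    (hcross : ∀ (j j' : Fin n) (k : Fin 2), (∑ ℓ : Fin n₀, cupProduct (rfl : 1 + 1 = 2)
        (avLetters g (fun tl : (Fin 2 × Fin 2) × Fin n₀ =>
          ofRatClassBaseChange (Motives.ComplexPoints A.X) 1 (cb tl)) (j, ((k, (0 : Fin 2)), ℓ)))
        (avLetters g (fun tl : (Fin 2 × Fin 2) × Fin n₀ =>
          ofRatClassBaseChange (Motives.ComplexPoints A.X) 1 (cb tl)) (j', ((k, (1 : Fin 2)), ℓ)))) ∈
      Submodule.span ℂ {c : complexBetti B.X 2 | IsRationalClass c ∧ IsOfHodgeType B.dim B.X 2 1 1 c})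
    (p : ℕ) (c : complexBetti B.X (2 * p)) (hcQ : IsRationalClass c)
    (hc : IsOfHodgeType B.dim B.X (2 * p) p p c) :
    c ∈ divisorClassesSpan B.X B.dim p := by
  classical
  rcases Nat.eq_zero_or_pos p with rfl | hp
  · exact AbelianVariety.mem_divisorClassesSpan_zero B c
  obtain ⟨a, hca, hkill⟩ := hg.exists_quarticInvariant_coeff hHD hI ψ hφE hE hdiv μ h11 h22 h12 h12' hV h1a h1b
    h2a cb κ hcbW hcbW' hcb0 hcb1 hdual hiso hp hcQ hc
  set y : (Fin n × (Fin 2 × Fin 2)) × Fin n₀ → complexBetti B.X 1 := fun x => avLetters g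
    (fun tl : (Fin 2 × Fin 2) × Fin n₀ => ofRatClassBaseChange (Motives.ComplexPoints A.X) 1 (cb tl))
    (x.1.1, (x.1.2, x.2)) with hy
  set F := cupPowOneAlt ℂ (Motives.ComplexPoints B.X) (2 * p) with hF
  rw [← hca, wordEval_eq_sum_wordSlice]
  refine Submodule.sum_mem _ fun U _ => ?_
  -- coloured Lie invariance ⟹ `GL(W_{μ₁}) × GL(W_{μ₂})`-invariance ⟹ colour-preserving complete contractions
  set ty : Fin (2 * p) → Bool := fun t => decide ((U t).2.2 = 0) with hty
  set col : Fin (2 * p) → Fin 2 := fun t => (U t).2.1 with hcol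
  have hLie : ∀ (i : Fin 2) (X : Matrix (Fin n₀) (Fin n₀) ℂ),
      wordDerAt ℂ (mixedLieFamilyAt col ty i X) (wordSlice a U) = 0 := by
    intro i X
    have hfam : mixedLieFamilyAt col ty i X = fun t => if (U t).2.1 = i then (if (U t).2.2 = 0 then X else -Xᵀ)
        else 0 := by
      funext t
      simp only [mixedLieFamilyAt, mixedLieFamily, hty, hcol, decide_eq_true_eq]
    rw [hfam]
    exact hkill U i X
  have hmem := mem_span_contractionTensor_of_forall_wordDerAt_mixedLieFamilyAt_eq_zero col ty hLie
  set Λ := Fintype.linearCombination ℂ (fun ε : Word n₀ (2 * p) => F (fun q => y (U q, ε q))) with hΛ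
  have hΛapply : ∀ cf : Word n₀ (2 * p) → ℂ, Λ cf = ∑ ε, cf ε • F (fun q => y (U q, ε q)) :=
    fun cf => Fintype.linearCombination_apply ℂ _ cf
  rw [← hΛapply]
  refine (Submodule.span_le (p := (divisorClassesSpan B.X B.dim p).comap Λ)).2 ?_ hmem
  rintro _ ⟨β, hβcol, rfl⟩
  rw [SetLike.mem_coe, Submodule.mem_comap, hΛapply]
  -- evaluation of a colour-preserving complete contraction: `±` a product of crossed classes of one colour each
  obtain ⟨π, eP, hsum⟩ := Milne1999.sum_contractionTensor_smul_eq F ty β y U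
  rw [hsum]
  refine Submodule.smul_mem _ _ ?_
  simp_rw [hF, cupPowOneAlt_apply]
  refine Milne1999.sum_cupPowOne_glPairWord_mem y p _ _ fun i => ?_
  have h0 : (U (eP.symm i : Fin (2 * p))).2.2 = 0 := by
    have h := (eP.symm i).2
    simpa [hty] using h
  have h1' : (U (β (eP.symm i) : Fin (2 * p))).2.2 = 1 := by
    have h := (β (eP.symm i)).2
    simp only [hty, decide_eq_false_iff_not] at h
    rcases Fin.eq_zero_or_eq_succ (U (β (eP.symm i) : Fin (2 * p))).2.2 with h' | ⟨j, hj⟩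
    · exact absurd h' h
    · rw [hj, Fin.eq_zero j]; rfl
  have hc' : (U (β (eP.symm i) : Fin (2 * p))).2.1 = (U (eP.symm i : Fin (2 * p))).2.1 := hβcol (eP.symm i)
  have hyU : ∀ (q : Fin (2 * p)) (ℓ : Fin n₀), y (U q, ℓ) = avLetters g (fun tl : (Fin 2 × Fin 2) × Fin n₀ =>
      ofRatClassBaseChange (Motives.ComplexPoints A.X) 1 (cb tl)) ((U q).1, (((U q).2.1, (U q).2.2), ℓ)) :=
    fun q ℓ => rfl
  simp only [hyU, h0, h1', hc']
  exact hcross _ _ _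

/-- **`IsDivisorGenerated B`** (the tree's spelling of `B•(B) = D•(B) ⊗ ℂ`) for every abelian variety `B` with
slots over an abelian variety `A` carrying the quartic CM data of multiplicities `{(1,1),(2,0)}` and crossed
classes in `B¹ ⊗ ℂ`. [cite: MoonenZarhin1999LowDim, Thm. (0.2)(4)] [cite: Milne1999LefschetzClasses, Prop. 3.6 (c)] -/
theorem AVSlots.isDivisorGenerated_of_quarticData [HodgeTensorFacts.{0, 0}] (hg : AVSlots A B g)
    (hHD : exists_isReal_hodgeModel) (hI : hodgePQ_independent_of_hodgeModel)
    (ψ : (BettiUniverse.hodge hHD (AbelianVariety.isSmoothProjective_holds (A := A)) 1).Polarization)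
    {φ : Module.End ℚ (bettiCohomology A.X 1)}
    (hφE : φ ∈ (BettiUniverse.hodge hHD (AbelianVariety.isSmoothProjective_holds (A := A)) 1).endAlg)
    (hE : ∀ a ∈ (BettiUniverse.hodge hHD (AbelianVariety.isSmoothProjective_holds (A := A)) 1).endAlg,
      ∃ q : Fin 4 → ℚ, a = ∑ k, q k • φ ^ (k : ℕ))
    (hdiv : ∀ a ∈ (BettiUniverse.hodge hHD (AbelianVariety.isSmoothProjective_holds (A := A)) 1).endAlg,
      a ≠ 0 → ∃ b : Module.End ℚ (bettiCohomology A.X 1), b * a = 1)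
    (μ : Fin 2 → ℂ) (h11 : starRingEnd ℂ (μ 0) ≠ μ 0) (h22 : starRingEnd ℂ (μ 1) ≠ μ 1) (h12 : μ 1 ≠ μ 0)
    (h12' : μ 1 ≠ starRingEnd ℂ (μ 0)) (hV : Module.finrank ℚ (bettiCohomology A.X 1) = 8)
    (h1a : Module.finrank ℂ ↥(Module.End.eigenspace (φ.baseChange ℂ) (μ 0) ⊓
      (BettiUniverse.hodge hHD (AbelianVariety.isSmoothProjective_holds (A := A)) 1).piece 1 0) = 1)
    (h1b : Module.finrank ℂ ↥(Module.End.eigenspace (φ.baseChange ℂ) (μ 0) ⊓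
      (BettiUniverse.hodge hHD (AbelianVariety.isSmoothProjective_holds (A := A)) 1).piece 0 1) = 1)
    (h2a : Module.finrank ℂ ↥(Module.End.eigenspace (φ.baseChange ℂ) (μ 1) ⊓
      (BettiUniverse.hodge hHD (AbelianVariety.isSmoothProjective_holds (A := A)) 1).piece 1 0) = 2)
    {n₀ : ℕ} (cb : Module.Basis ((Fin 2 × Fin 2) × Fin n₀) ℂ (ℂ ⊗[ℚ] bettiCohomology A.X 1))
    (κ : Fin 2 × Fin n₀ → Fin 2)
    (hcbW : ∀ k ℓ, cb ((k, 0), ℓ) ∈ Module.End.eigenspace (φ.baseChange ℂ) (μ k))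
    (hcbW' : ∀ k ℓ, cb ((k, 1), ℓ) ∈ Module.End.eigenspace (φ.baseChange ℂ) (starRingEnd ℂ (μ k)))
    (hcb0 : ∀ k ℓ, κ (k, ℓ) = 0 →
      cb ((k, 0), ℓ) ∈ (BettiUniverse.hodge hHD (AbelianVariety.isSmoothProjective_holds (A := A)) 1).piece 1 0 ∧
      cb ((k, 1), ℓ) ∈ (BettiUniverse.hodge hHD (AbelianVariety.isSmoothProjective_holds (A := A)) 1).piece 0 1)
    (hcb1 : ∀ k ℓ, κ (k, ℓ) = 1 →
      cb ((k, 0), ℓ) ∈ (BettiUniverse.hodge hHD (AbelianVariety.isSmoothProjective_holds (A := A)) 1).piece 0 1 ∧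
      cb ((k, 1), ℓ) ∈ (BettiUniverse.hodge hHD (AbelianVariety.isSmoothProjective_holds (A := A)) 1).piece 1 0)
    (hdual : ∀ k k' i j, ψ.form.baseChange ℂ (cb ((k, 0), i)) (cb ((k', 1), j)) =
      if k = k' ∧ i = j then 1 else 0)
    (hiso : ∀ k k' (t : Fin 2) i j, ψ.form.baseChange ℂ (cb ((k, t), i)) (cb ((k', t), j)) = 0)
    (hcross : ∀ (j j' : Fin n) (k : Fin 2), (∑ ℓ : Fin n₀, cupProduct (rfl : 1 + 1 = 2)
        (avLetters g (fun tl : (Fin 2 × Fin 2) × Fin n₀ =>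
          ofRatClassBaseChange (Motives.ComplexPoints A.X) 1 (cb tl)) (j, ((k, (0 : Fin 2)), ℓ)))
        (avLetters g (fun tl : (Fin 2 × Fin 2) × Fin n₀ =>
          ofRatClassBaseChange (Motives.ComplexPoints A.X) 1 (cb tl)) (j', ((k, (1 : Fin 2)), ℓ)))) ∈
      Submodule.span ℂ {c : complexBetti B.X 2 | IsRationalClass c ∧ IsOfHodgeType B.dim B.X 2 1 1 c}) :
    IsDivisorGenerated B :=
  fun p c hcQ hc => hg.quarticHodgeClasses_divisorial hHD hI ψ hφE hE hdiv μ h11 h22 h12 h12' hV h1a h1b h2a cb κ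
    hcbW hcbW' hcb0 hcb1 hdual hiso hcross p c hcQ hc

end QuarticAssembly

end Literature.AlgebraicGeometry.HodgeTheory

end
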